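/-
Copyright (c) 2026 the pub-hodgecm-mathlib formalisation cell (harness21).  Prover seat hodgecm-mathlib-K2Liu-p13 (g2), Track B «K2-LIT»,
#184♮ = hLiu418 = `stmt-HodgeConjecture-24832`; D-U1 stage 3 input I2 (LEAD F0P6-plan (g14) BATCH #23 (2); K2E5-plan (g7) «=» 13:54:17Z), file 1 of 2.
-/
import Summits.HodgeConjecture.HodgeConjecture.Theorems.K2LiuKlingenCellOneSum                 -- ★ F5-b (letters; + ★ `K2LiuKlingenRationalCells.transport_toAdelic_mem_ratH`, ★ F4-3b `toAdelic_nKlingen_eq_jAdelic`)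
import Summits.HodgeConjecture.HodgeConjecture.Theorems.K2LiuKlingenUnipotentAdelicChart        -- ★ F5-i: `continuous_transport_nKlingen`
import Summits.HodgeConjecture.HodgeConjecture.Theorems.K2LiuKlingenUnipotentClosed             -- ★ F5-r: `isClosed_klingenUnipA`
import Summits.HodgeConjecture.HodgeConjecture.Theorems.K2LiuSiegelDoubledRationalMultiplicity  -- ★ `finite_ratH_inter`
import Literature.NumberTheory.Automorphic.UnitaryGroupTraceZeroLine                             -- ★ `traceZeroLine : 𝔸_{L⁺} ≃ₜ+ 𝔸_L⁻`, `coe_traceZeroLine_algebraMap`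
import Literature.NumberTheory.Automorphic.AdelicFundamentalDomain                               -- ★ Tate: `existsUnique_add_algebraMap_mem_adeleFundamentalDomain`, `exists_isCompact_adeleFundamentalDomain_subset`
import Literature.NumberTheory.Weil1982.UnitaryLocalRingBaseField                                -- ★ `exists_complexConj_eq_neg_ne_zero`
import HarnessLib

/-!
# Crux `HLiu418`, D-U1 stage 3 input I2, file 1: `N_Q(L⁺)\N_Q(𝔸)` IS COMPACT — a compact `K ⊆ N_Q(𝔸)` meeting every left `N_Q(L⁺)`-orbit, and finiteness of
# `{γ ∈ N_Q(L⁺) : γ·u ∈ K}` (the Klingen twin of ★ `K2LiuUnipotentCoveringWeight` (C0) for `N_Δ`)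

Cell `hodgecm-mathlib`, crux item hLiu418 = `stmt-HodgeConjecture-24832`; squad K2 ∕ K2Liu; LEAD F0P6-plan (g14), co-dealer K2E5-plan (g7); prover K2Liu-p13 (g2).
THEOREMS ONLY (no `def`, no instance, no notation, no named-fact hypothesis, no `sorry`); lane `--supports stmt-HodgeConjecture-24832 --as helper` (count-neutral).
`N_Q(𝔸) = klingenUnipA Ψ = {Ψ(jAdelic n_Q(y,z,t))}` (`y ∈ 𝔸_L⁻` skew, `z, t ∈ 𝔸_L`; group law ★ `nKlingen_mul`: `(z,t)` add, `y` picks up the skew cross term), `N_Q(L⁺) = N_Q(𝔸) ∩ H(L⁺)`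
(rational letters, ★ `exists_mem_klingenUnip_of_mem_ratH` ∕ `transport_toAdelic_mem_ratH`).  Tate's theorem (★ `AdelicFundamentalDomain`: `ι(L) + D = 𝔸_L`, `D̄` compact) for the
coordinates `z, t`, and — transported along the line dictionary ★ `traceZeroLine : 𝔸_{L⁺} ≃ₜ+ 𝔸_L⁻`, `θ(ι⁺ξ) = ι(ξδ)` — for the skew coordinate `y`, give rational letters moving any
`u ∈ N_Q(𝔸)` into the compact image `K` of `θ(C⁺) × C × C` under the continuous chart (★ F5-i); `H(L⁺)` is discrete in `H(𝔸)` (★ `finite_ratH_inter`) so only finitely many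
`γ ∈ N_Q(L⁺)` move a given `u` into `K`.
* `exists_rat_add_mem` ∕ `exists_skewRat_add_mem` — Tate moves for `𝔸_L` and for the skew line;
* **`exists_isCompact_cover_klingenUnipA`** — (C0)_Q: `∃ K` compact, `∀ u, ∃ γ ∈ N_Q(L⁺), γ • u ∈ K`;
* **`finite_klingenRat_smul_mem`** — `{γ : γ • u ∈ K}` finite for compact `K`.
[CasselsFrohlichANT1967, Ch. II §14, Ch. XV Thm 4.1.3], [MoeglinWaldspurger1995, I.2.1, II.1.6], [Borel1963, §1.2].
HONEST LABEL.  Count-neutral helper: `HC_CM` is proved only modulo the 7 printed citations (2 remaining named inputs: hLiu418 = `stmt-HodgeConjecture-24832`,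
h413 = `stmt-HodgeConjecture-24833`) until rung 0 closes.
-/

set_option autoImplicit false
set_option linter.dupNamespace false -- the mandated namespace repeats `HodgeConjecture.HodgeConjecture`

noncomputable section

open scoped Matrix
open NumberField IsDedekindDomain MulAction

namespace Summit.HodgeConjecture.HodgeConjecture.Cruxes.HLiu418.K2LiuKlingenUnipotentCocompact

open Literature.NumberTheory.Automorphic Literature.NumberTheory.Automorphic.UnitaryGroup
open Literature.NumberTheory.GelbartRogawski1991 Literature.NumberTheory.GelbartRogawski1991.GRConstruction
open Summit.HodgeConjecture.HodgeConjecture.Cruxes.HLiu418.K2LiuDoubledUTwoTwoBorelFrame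
open Summit.HodgeConjecture.HodgeConjecture.Cruxes.HLiu418.K2LiuKlingenParabolicDefs
open Summit.HodgeConjecture.HodgeConjecture.Cruxes.HLiu418.K2LiuKlingenUnipotentDefs
open Summit.HodgeConjecture.HodgeConjecture.Cruxes.HLiu418.K2LiuKlingenUnipotentAdelicDefs
open Summit.HodgeConjecture.HodgeConjecture.Cruxes.HLiu418.K2LiuKlingenRationalCells (complexConj_ringHom_apply_apply transport_toAdelic_mem_ratH)
open Summit.HodgeConjecture.HodgeConjecture.Cruxes.HLiu418.K2LiuKlingenCellXiOrbits (toAdelic_nKlingen_eq_jAdelic conjAdele_algebraMap_of_skew)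
open Summit.HodgeConjecture.HodgeConjecture.Cruxes.HLiu418.K2LiuKlingenUnipotentAdelicChart (continuous_transport_nKlingen)
open Summit.HodgeConjecture.HodgeConjecture.Cruxes.HLiu418.K2LiuKlingenUnipotentClosed (isClosed_klingenUnipA)
open Summit.HodgeConjecture.HodgeConjecture.Cruxes.HLiu418.K2LiuSiegelDoubledRationalMultiplicity (finite_ratH_inter)
open Summit.HodgeConjecture.HodgeConjecture.Cruxes.HLiu418.K2LiuSiegelDoubledLeviMatrix (conjAdele_conjAdele')
open UnitaryDualPair

variable {L : Type} [Field L] [NumberField L] [IsCMField L]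
variable {N M : ℕ} {e : Fin N × Fin M ≃ Fin 2}
  {dV : Fin N → L} {hdV : ∀ i, IsCMField.complexConj L (dV i) = dV i}
  {dW : Fin M → L} {hdW : ∀ i, IsCMField.complexConj L (dW i) = dW i}

section Transport

variable {SA : GL (Fin (2 + 2)) (AdeleRing (𝓞 L) L)}
  {Ψ : (quasiSplit (Fp L) L (IsCMField.complexConj L) (2 + 2)).Adelic ≃ₜ* HA L e dV hdV dW hdW} {X Y : Matrix (Fin 2) (Fin 2) (Fp L)} {a : Fp L}
  (hΨ : ∀ g : (quasiSplit (Fp L) L (IsCMField.complexConj L) (2 + 2)).Adelic,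
    (((Ψ g : HA L e dV hdV dW hdW) : GL (Fin (2 + 2)) (AdeleRing (𝓞 L) L)) : Matrix (Fin (2 + 2)) (Fin (2 + 2)) (AdeleRing (𝓞 L) L)) =
      (SA : Matrix (Fin (2 + 2)) (Fin (2 + 2)) (AdeleRing (𝓞 L) L)) *
        ((adelicVal (Fp L) L (IsCMField.complexConj L) (2 + 2) _ g : GL (Fin (2 + 2)) (AdeleRing (𝓞 L) L)) :
          Matrix (Fin (2 + 2)) (Fin (2 + 2)) (AdeleRing (𝓞 L) L)) *
        ((SA⁻¹ : GL (Fin (2 + 2)) (AdeleRing (𝓞 L) L)) : Matrix (Fin (2 + 2)) (Fin (2 + 2)) (AdeleRing (𝓞 L) L)))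
  (ha : a + a = 1)
  (hSA : Matrix.reindex (e₂ (n := 2)).symm (e₂ (n := 2)).symm (SA : Matrix (Fin (2 + 2)) (Fin (2 + 2)) (AdeleRing (𝓞 L) L)) =
    Matrix.fromBlocks (1 : Matrix (Fin 2) (Fin 2) (AdeleRing (𝓞 L) L)) (X.map ((algebraMap L (AdeleRing (𝓞 L) L)).comp (algebraMap (Fp L) L))) 1
      (-(X.map ((algebraMap L (AdeleRing (𝓞 L) L)).comp (algebraMap (Fp L) L)))))
  (hSAi : Matrix.reindex (e₂ (n := 2)).symm (e₂ (n := 2)).symm ((SA⁻¹ : GL (Fin (2 + 2)) (AdeleRing (𝓞 L) L)) : Matrix (Fin (2 + 2)) (Fin (2 + 2)) (AdeleRing (𝓞 L) L)) =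
    Matrix.fromBlocks ((a • (1 : Matrix (Fin 2) (Fin 2) (Fp L))).map ((algebraMap L (AdeleRing (𝓞 L) L)).comp (algebraMap (Fp L) L)))
      ((a • (1 : Matrix (Fin 2) (Fin 2) (Fp L))).map ((algebraMap L (AdeleRing (𝓞 L) L)).comp (algebraMap (Fp L) L)))
      (Y.map ((algebraMap L (AdeleRing (𝓞 L) L)).comp (algebraMap (Fp L) L)))
      (-(Y.map ((algebraMap L (AdeleRing (𝓞 L) L)).comp (algebraMap (Fp L) L)))))
  (hXY : X * Y = a • (1 : Matrix (Fin 2) (Fin 2) (Fp L))) (hYX : Y * X = a • (1 : Matrix (Fin 2) (Fin 2) (Fp L)))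

/-! ## §1 Tate moves -/

omit [IsCMField L] in
/-- **Tate's move on `𝔸_L`**: a compact `C ⊆ 𝔸_L` with `∀ a, ∃ ξ ∈ L, ι(ξ) + a ∈ C`. [cite: CasselsFrohlichANT1967, Ch. XV Thm 4.1.3] -/
theorem exists_rat_add_mem : ∃ C : Set (AdeleRing (𝓞 L) L), IsCompact C ∧ ∀ a : AdeleRing (𝓞 L) L, ∃ ξ : L, algebraMap L (AdeleRing (𝓞 L) L) ξ + a ∈ C := by
  obtain ⟨C, hC, -, hDC⟩ := Literature.NumberTheory.Automorphic.exists_isCompact_adeleFundamentalDomain_subset (K := L)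
  exact ⟨C, hC, fun a => by
    obtain ⟨ξ, hξ, -⟩ := Literature.NumberTheory.Automorphic.existsUnique_add_algebraMap_mem_adeleFundamentalDomain (K := L) a
    exact ⟨ξ, hDC hξ⟩⟩

/-- **Tate's move on the skew line** (through ★ `traceZeroLine`): a compact `C ⊆ 𝔸_L` with `∀ y` skew, `∃ η ∈ L` skew, `ι(η) + y ∈ C`. [cite: CasselsFrohlichANT1967, Ch. II §14] -/
theorem exists_skewRat_add_mem : ∃ C : Set (AdeleRing (𝓞 L) L), IsCompact C ∧ ∀ y : AdeleRing (𝓞 L) L, conjAdele (Fp L) L (IsCMField.complexConj L) y = -y →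
    ∃ η : L, IsCMField.complexConj L η = -η ∧ algebraMap L (AdeleRing (𝓞 L) L) η + y ∈ C := by
  obtain ⟨δ, hcδ, hδ⟩ := Literature.NumberTheory.Weil1982.UnitaryFinTopForm.exists_complexConj_eq_neg_ne_zero (L := L)
  obtain ⟨C, hC, -, hDC⟩ := Literature.NumberTheory.Automorphic.exists_isCompact_adeleFundamentalDomain_subset (K := Fp L)
  set θ := traceZeroLine (Fp L) L (IsCMField.complexConj L) hcδ hδ with hθ
  refine ⟨Subtype.val '' (θ '' C), (hC.image θ.continuous).image continuous_subtype_val, fun y hy => ?_⟩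
  obtain ⟨ξ, hξ, -⟩ := Literature.NumberTheory.Automorphic.existsUnique_add_algebraMap_mem_adeleFundamentalDomain (K := Fp L) (θ.symm ⟨y, (mem_traceZeroAdele_iff _).2 hy⟩)
  refine ⟨algebraMap (Fp L) L ξ * δ, by rw [map_mul, hcδ, AlgEquiv.commutes, mul_neg], ⟨θ (algebraMap (Fp L) _ ξ + θ.symm ⟨y, _⟩), ⟨_, hDC hξ, rfl⟩, ?_⟩⟩
  rw [map_add, ContinuousAddEquiv.apply_symm_apply, AddSubgroup.coe_add, coe_traceZeroLine_algebraMap]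

/-! ## §2 (C0)_Q: a compact set meeting every orbit -/

include hΨ ha hSA hSAi hXY hYX in
/-- **`N_Q(L⁺)\N_Q(𝔸)` IS COMPACT**: there is a compact `K ⊆ N_Q(𝔸)` such that every `u ∈ N_Q(𝔸)` has a rational left translate `γ • u ∈ K`, `γ ∈ N_Q(L⁺) = N_Q(𝔸) ∩ H(L⁺)`
(one rational letter `n_Q(η, ζ, τ)`: `ζ, τ` by Tate on `𝔸_L`, then `η` by Tate on the skew line for the cross-term-shifted coordinate). [cite: MoeglinWaldspurger1995, I.2.1] [cite: Borel1963, §1.2] -/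
theorem exists_isCompact_cover_klingenUnipA : ∃ K : Set ↥(klingenUnipA Ψ), IsCompact K ∧
    ∀ u : ↥(klingenUnipA Ψ), ∃ γ : ↥((ratH L e dV hdV dW hdW).subgroupOf (klingenUnipA Ψ)), γ • u ∈ K := by
  obtain ⟨CZ, hCZ, hZ⟩ := exists_rat_add_mem (L := L)
  obtain ⟨CY, hCY, hYmv⟩ := exists_skewRat_add_mem (L := L)
  -- the compact image of `(C_Y ∩ 𝔸⁻) × C × C` under the chart
  set K₀ : Set (HA L e dV hdV dW hdW) := (fun p : ↥(traceZeroAdele (Fp L) L (IsCMField.complexConj L)) × (AdeleRing (𝓞 L) L) × (AdeleRing (𝓞 L) L) => Ψ (jAdelic L 4 (nKlingen (AdeleRing (𝓞 L) L) (conjAdele (Fp L) L (IsCMField.complexConj L)) (conjAdele_conjAdele' L) (((p.1 : ↥(traceZeroAdele (Fp L) L (IsCMField.complexConj L))) : AdeleRing (𝓞 L) L)) ((mem_traceZeroAdele_iff _).1 p.1.2) (p.2.1) (p.2.2)))) '' ((Subtype.val ⁻¹' CY) ×ˢ (CZ ×ˢ CZ)) with hK₀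
  have hg : Continuous (fun p : ↥(traceZeroAdele (Fp L) L (IsCMField.complexConj L)) × (AdeleRing (𝓞 L) L) × (AdeleRing (𝓞 L) L) => Ψ (jAdelic L 4 (nKlingen (AdeleRing (𝓞 L) L) (conjAdele (Fp L) L (IsCMField.complexConj L)) (conjAdele_conjAdele' L) (((p.1 : ↥(traceZeroAdele (Fp L) L (IsCMField.complexConj L))) : AdeleRing (𝓞 L) L)) ((mem_traceZeroAdele_iff _).1 p.1.2) (p.2.1) (p.2.2)))) :=
    continuous_transport_nKlingen hΨ (fun p : ↥(traceZeroAdele (Fp L) L (IsCMField.complexConj L)) × (AdeleRing (𝓞 L) L) × (AdeleRing (𝓞 L) L) => (mem_traceZeroAdele_iff _).1 p.1.2)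
      (continuous_subtype_val.comp continuous_fst) (continuous_fst.comp continuous_snd) (continuous_snd.comp continuous_snd)
  have hCY' : IsCompact (Subtype.val ⁻¹' CY : Set ↥(traceZeroAdele (Fp L) L (IsCMField.complexConj L))) :=
    (Topology.IsClosedEmbedding.subtypeVal (isClosed_traceZeroAdele (F := Fp L) (E := L) (c := IsCMField.complexConj L))).isCompact_preimage hCY
  have hK₀c : IsCompact K₀ := (hCY'.prod (hCZ.prod hCZ)).image hg
  refine ⟨Subtype.val ⁻¹' K₀, (Topology.IsClosedEmbedding.subtypeVal (isClosed_klingenUnipA Ψ)).isCompact_preimage hK₀c, fun u => ?_⟩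
  obtain ⟨y, hy, z, t, hu⟩ := (mem_klingenUnipA_iff Ψ (u : HA L e dV hdV dW hdW)).1 u.2
  -- move `z` and `t`
  obtain ⟨ζ, hζ⟩ := hZ z
  obtain ⟨τ, hτ⟩ := hZ t
  -- the new skew coordinate and its move
  obtain ⟨η, hη, hηC⟩ := hYmv (y + (z * conjAdele (Fp L) L (IsCMField.complexConj L) (algebraMap L (AdeleRing (𝓞 L) L) τ) - algebraMap L (AdeleRing (𝓞 L) L) τ * conjAdele (Fp L) L (IsCMField.complexConj L) z))
    (skew_add hy (skew_comm (conjAdele_conjAdele' L) z (algebraMap L (AdeleRing (𝓞 L) L) τ)))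
  -- the rational letter `γ = n_Q(η, ζ, τ)`
  have hη' : ((IsCMField.complexConj L : L ≃ₐ[Fp L] L) : L →+* L) η = -η := hη
  set n₁ := nKlingen L ((IsCMField.complexConj L : L ≃ₐ[Fp L] L) : L →+* L) (complexConj_ringHom_apply_apply L) η hη' ζ τ with hn₁
  have h₁ : Ψ (UnitaryGroup.toAdelic (Fp L) L (IsCMField.complexConj L) (2 + 2) ((StdForm.antidiagonal (2 + 2)).over L) n₁) = Ψ (jAdelic L 4 (nKlingen (AdeleRing (𝓞 L) L) (conjAdele (Fp L) L (IsCMField.complexConj L)) (conjAdele_conjAdele' L)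
      (algebraMap L (AdeleRing (𝓞 L) L) η) (conjAdele_algebraMap_of_skew hη') (algebraMap L (AdeleRing (𝓞 L) L) ζ) (algebraMap L (AdeleRing (𝓞 L) L) τ))) := by
    rw [hn₁, toAdelic_nKlingen_eq_jAdelic]
  have hγmem : Ψ (UnitaryGroup.toAdelic (Fp L) L (IsCMField.complexConj L) (2 + 2) ((StdForm.antidiagonal (2 + 2)).over L) n₁) ∈ klingenUnipA Ψ := by
    rw [h₁]; exact transport_nKlingen_mem Ψ _ _ _ _
  have hγrat : Ψ (UnitaryGroup.toAdelic (Fp L) L (IsCMField.complexConj L) (2 + 2) ((StdForm.antidiagonal (2 + 2)).over L) n₁) ∈ ratH L e dV hdV dW hdW := transport_toAdelic_mem_ratH hΨ ha hSA hSAi hXY hYX _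
  refine ⟨⟨⟨_, hγmem⟩, Subgroup.mem_subgroupOf.2 hγrat⟩, ?_⟩
  -- `γ • u = Ψ(jAdelic n_Q(η + y + cross, ζ + z, τ + t))` lies in `K₀`
  show Ψ (UnitaryGroup.toAdelic (Fp L) L (IsCMField.complexConj L) (2 + 2) ((StdForm.antidiagonal (2 + 2)).over L) n₁) * (u : HA L e dV hdV dW hdW) ∈ K₀
  rw [h₁, hu, ← map_mul Ψ, ← map_mul (jAdelic L 4), nKlingen_mul]
  have hYC : algebraMap L (AdeleRing (𝓞 L) L) η + y + (z * conjAdele (Fp L) L (IsCMField.complexConj L) (algebraMap L (AdeleRing (𝓞 L) L) τ) - algebraMap L (AdeleRing (𝓞 L) L) τ * conjAdele (Fp L) L (IsCMField.complexConj L) z) ∈ CY := by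
    simpa only [add_assoc] using hηC
  exact ⟨⟨⟨_, (mem_traceZeroAdele_iff _).2 (skew_add (skew_add (conjAdele_algebraMap_of_skew hη') hy)
      (skew_comm (conjAdele_conjAdele' L) z (algebraMap L (AdeleRing (𝓞 L) L) τ)))⟩, (algebraMap L (AdeleRing (𝓞 L) L) ζ + z, algebraMap L (AdeleRing (𝓞 L) L) τ + t)⟩, ⟨hYC, hζ, hτ⟩, rfl⟩

/-! ## §3 Finiteness -/

/-- **only finitely many `γ ∈ N_Q(L⁺)` move `u` into a compact `K`** (`H(L⁺)` is discrete in `H(𝔸)`: ★ `finite_ratH_inter`). [cite: Borel1963, §1.2] -/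
theorem finite_klingenRat_smul_mem {K : Set ↥(klingenUnipA Ψ)} (hK : IsCompact K) (u : ↥(klingenUnipA Ψ)) :
    {γ : ↥((ratH L e dV hdV dW hdW).subgroupOf (klingenUnipA Ψ)) | γ • u ∈ K}.Finite := by
  set C : Set (HA L e dV hdV dW hdW) := (fun k : ↥(klingenUnipA Ψ) => (k : HA L e dV hdV dW hdW) * ((u : HA L e dV hdV dW hdW))⁻¹) '' K with hCdef
  have hC : IsCompact C := hK.image (continuous_subtype_val.mul continuous_const)
  have hfin := finite_ratH_inter L e dV hdV dW hdW hC
  let ι : ↥((ratH L e dV hdV dW hdW).subgroupOf (klingenUnipA Ψ)) → HA L e dV hdV dW hdW := fun γ => ((γ : ↥(klingenUnipA Ψ)) : HA L e dV hdV dW hdW)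
  have hι : Function.Injective ι := fun γ γ' h => Subtype.ext (Subtype.ext h)
  refine (hfin.preimage hι.injOn).subset fun γ hγ => ?_
  rw [Set.mem_setOf_eq] at hγ
  refine ⟨Subgroup.mem_subgroupOf.1 γ.2, ⟨γ • u, hγ, ?_⟩⟩
  change ((((γ : ↥(klingenUnipA Ψ)) * u : ↥(klingenUnipA Ψ)) : HA L e dV hdV dW hdW)) * ((u : HA L e dV hdV dW hdW))⁻¹ = ι γ
  rw [Subgroup.coe_mul, mul_inv_cancel_right]

end Transport

end Summit.HodgeConjecture.HodgeConjecture.Cruxes.HLiu418.K2LiuKlingenUnipotentCocompact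

end
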